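import Literature.AlgebraicGeometry.ModuliOfAbelianVarieties.SiegelFineModuliSchemeLevelGroupQuotient
import Literature.AlgebraicGeometry.ModuliOfAbelianVarieties.SiegelFineModuliSchemeLevelKernelActionFree
import Literature.AlgebraicGeometry.ModuliOfAbelianVarieties.SiegelFineModuliSchemeLevelQuotientTwistOnUniversal
import Literature.AlgebraicGeometry.AbelianSchemes.AbelianSchemeBaseQuotientDescentOfQuasiProjective
import Literature.AlgebraicGeometry.AbelianSchemes.PolarizedTripleBaseQuotientDescent
import Literature.AlgebraicGeometry.AbelianSchemes.DualQuasiProjectiveOfPolarization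
import Literature.AlgebraicGeometry.AbelianSchemes.AbelianSchemeOverHomOfReduced
import Literature.AlgebraicGeometry.RelativeSpec.FreeActionOfPoints
import HarnessLib

/-!
# The universal level-`N₀` triple of a fine Siegel moduli scheme descends to the quotient `M/Δ` by the level-`N₀` kernel
# ([MumfordFogartyKirwan1994] Ch. 7 §3, remark after Thm. 7.9 and Lemma 7.11 (pp. 139–140): `A_{g,δ,N₀} = A_{g,δ,N}/Γ`)

Cell `hodgecm-mathlib` (D-0151), F-DAG F-10 (b) TAIL «(10a)-ON-Q» FILE B (B-plan1 (g16) 07:35:53Z / 07:40:03Z /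
07:42:19Z; census `B-provers/B-p13/g19/CENSUS-F10b-10aOnQ.B-p13g19.md`).  PROOF lane, theorems only (no definition, no
named fact, no instance, no `sorry`).  Consumers: (b2′) PROPER (B-p14 (g18)), (pack) (B-p02 (g13)), (10c) (B-p06 (g12)).

THE ASSEMBLY.  For a fine moduli carrier `𝓜 = (M, X_univ)` of level `N = N₀ d` (`N₀ ≥ 3`) over `ℚ` with `M` reduced and
the three (F) clauses «`M` quasi-projective, the universal total space quasi-projective» (`hqp`, `hqpA`):
* ★ (Q) `exists_levelGroupQuotient_action` (B-p02 (g13)): the finite group `Δ = red(K_δ(N₀)) ≤ GL_{2g}(ℤ/N)` acts on `M`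
  over `ℚ` through the twist operators and `p : M → Q := M/Δ` is Mumford's quotient — an affine geometric quotient,
  finite, `Q` separated, locally of finite type and quasi-projective over `ℚ`, with the universal property;
* ★ (Q-free) `levelKernel_action_comp_ne` (B-p15 (g12)) + ★ `ActionOver.free_of_forall_comp_aut_ne`: the action is FREE
  (`N₀ ≥ 3`: rigidity), hence ★ `IsGeometricQuotient.etale_of_free`: `p` is ÉTALE;
* ★ (O-A) `exists_action_on_universal_changeLevel` (B-p14 (g17)): `Δ` acts on the universal abelian scheme `A` and on its
  dual `Â` over the action on `M`, by automorphisms of the level-`N₀` triple `X := X_univ.changeLevel N₀`;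
* ★ FILE A `exists_abelianScheme_desc_of_isQuasiProjectiveOver₀` (twice — for `A`, whose total space is quasi-projective
  by `hqpA`, and for `Â`, whose total space is quasi-projective by ★ `isQuasiProjectiveOver_univ_hat` (B-p15 (g12), road E:
  a quasi-inverse of `λ` is finite)): `A`, `Â` descend to abelian schemes `B`, `B̂` over `Q` with quasi-projective total
  spaces, the quotient maps `π`, `π̂` being affine geometric quotients;
* ★ (10a) `PolarizedAbelianSchemeWithLevel.exists_triple_desc_of_free_base_quotient` (B-p06 (g11)): the Poincaré bundle,
  the polarisation (with its type `δ`) and the symplectic-liftable level-`N₀` structure descend COMPATIBLY, giving a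
  polarised level-`N₀` triple `X_Q` over `Q` with `X ≅ p^* X_Q` (★ `IsBaseChangeVia` along `p`, `π`, `π̂`).

* **`exists_univ_desc_levelGroupQuotient`** — the head: `∃ red Δ act Q p ρ X_Q π π̂`, all the (Q) clauses (verbatim, so
  that ★ (b2)/(b3)/(b2′) read ONE existential) `∧ Etale p.left ∧ Surjective p.left ∧ IsLocallyNoetherian Q.left ∧
  X.IsBaseChangeVia X_Q p.left π π̂ ∧` the descended total spaces `X_Q.A`, `X_Q.D.hat` are QUASI-PROJECTIVE over `ℚ`;
* `exists_univ_desc_levelGroupQuotient_of_smooth` — the same with `[Smooth 𝓜.M.hom]` (the (F) clause) for `[IsReduced]`.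

HC_CM is proved only modulo the 7 printed citations until rung 0 closes; count-neutral F-DAG capital.

## References
* [MumfordFogartyKirwan1994] D. Mumford, J. Fogarty, F. Kirwan, *Geometric Invariant Theory*, 3rd ed. (1994), Ch. 7 §1
  Prop. 7.1 (p. 127); Ch. 7 §2 Def. 7.2 (p. 129); Ch. 7 §3 Thm. 7.9, the remark after it, and Lemma 7.11 (pp. 139–140).
* [MumfordAV1970] D. Mumford, *Abelian Varieties* (1970), §7 Thm. p. 66 and Remark p. 69.
* [SGA1] A. Grothendieck, *SGA 1*, Exp. V Prop. 2.6, Exp. VIII Cor. 7.8.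
-/

noncomputable section

open CategoryTheory CategoryTheory.Limits AlgebraicGeometry

namespace Literature.AlgebraicGeometry.ModuliOfAbelianVarieties

namespace SiegelFineModuliScheme

open Literature.AlgebraicGeometry.Motives Literature.AlgebraicGeometry.HodgeTheory
open Literature.AlgebraicGeometry.AbelianSchemes (PolarizedAbelianSchemeWithLevel)
open Literature.AlgebraicGeometry.AbelianSchemes.AbelianSchemeOver Literature.AlgebraicGeometry.RelativeSpec
open Literature.NumberTheory.Adeles NumberField IsDedekindDomain

open scoped Matrix

variable {g N : ℕ} {δ : Fin g → ℕ} (𝓜 : SiegelFineModuliScheme g N δ) [IsCommMonObj 𝓜.univ.A.X] [NeZero N]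

/-- **THE UNIVERSAL LEVEL-`N₀` TRIPLE DESCENDS TO `Q = M/Δ`** ([MumfordFogartyKirwan1994] Ch. 7 §3, remark after Thm. 7.9
and Lemma 7.11: `A_{g,δ,N₀} = A_{g,δ,N}/Γ` with its universal family).  For a fine moduli carrier `𝓜` of level
`N = N₀ d`, `N₀ ≥ 3`, over `ℚ`, with `𝓜.M` reduced and quasi-projective and universal total space quasi-projective over
`ℚ`: the level-`N₀` kernel `Δ` acts on `M` (★ `exists_levelGroupQuotient_action`, all of whose clauses are re-exported),
the quotient `p : M → Q` is a finite ÉTALE surjective geometric quotient (the action is free: ★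
`levelKernel_action_comp_ne`), `Q` is locally Noetherian, and the level-changed universal triple
`X = 𝓜.univ.changeLevel N₀ d` is the pull-back along `p` of a polarised abelian scheme `X_Q` of type `δ` with
symplectic-liftable level-`N₀` structure over `Q` (★ FILE A twice + ★ `exists_triple_desc_of_free_base_quotient`), whose
abelian scheme and dual have total spaces QUASI-PROJECTIVE over `ℚ` ([MumfordAV1970] §7 Remark p. 69).
[cite: MumfordFogartyKirwan1994, Ch. 7 §3, remark after Thm. 7.9 and Lemma 7.11 (pp. 139–140)]
[cite: MumfordFogartyKirwan1994, Ch. 7 §2 Definition 7.2 (p. 129)] [cite: MumfordAV1970, §7 Thm. p. 66 and Remark p. 69]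
[cite: SGA1, Exp. V Prop. 2.6 (i), Déf. 2.7] -/
theorem exists_univ_desc_levelGroupQuotient [IsReduced 𝓜.M.left] (hδ : IsPolarizationType δ) (hg : 0 < g)
    {N₀ d : ℕ} [NeZero N₀] (hd : N = N₀ * d) (hN₀ : 3 ≤ N₀) (hqp : IsQuasiProjectiveOver 𝓜.M)
    (hqpA : IsQuasiProjectiveOver (Over.mk (𝓜.univ.A.X.hom ≫ 𝓜.M.hom) : SchemeOver ℚ)) :
    ∃ (red : principalLevelSubgroup δ 1 →* GL (Fin g ⊕ Fin g) (ZMod N))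
      (Δ : Subgroup (GL (Fin g ⊕ Fin g) (ZMod N))) (act : Δ →* Aut 𝓜.M)
      (Q : SchemeOver ℚ) (p : 𝓜.M ⟶ Q) (ρ : ActionOver p.left Δ)
      (X_Q : PolarizedAbelianSchemeWithLevel g N₀ δ Q.left)
      (π : 𝓜.univ.A.X.left ⟶ X_Q.A.X.left) (πh : 𝓜.univ.D.hat.X.left ⟶ X_Q.D.hat.X.left),
      (∀ (k : principalLevelSubgroup δ 1) (i j : Fin g ⊕ Fin g)
        (h : (((k : gspFinAdelic δ) : GL (Fin g ⊕ Fin g) finAdeleQ) :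
            Matrix (Fin g ⊕ Fin g) (Fin g ⊕ Fin g) finAdeleQ) i j ∈ FiniteAdeleRing.integralAdeles (𝓞 ℚ) ℚ),
        (red k : Matrix (Fin g ⊕ Fin g) (Fin g ⊕ Fin g) (ZMod N)) i j = integralAdeleResidue N ⟨_, h⟩) ∧
      (∀ k : principalLevelSubgroup δ 1, (k : gspFinAdelic δ) ∈ principalLevelSubgroup δ N₀ → red k ∈ Δ) ∧
      (∀ x : Δ, ∃ k : principalLevelSubgroup δ 1, (k : gspFinAdelic δ) ∈ principalLevelSubgroup δ N₀ ∧ red k = x) ∧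
      (∀ (k : principalLevelSubgroup δ 1) (hk : red k ∈ Δ),
        ∃ hs : (𝓜.univ.level.twist (red k)).IsSymplecticLiftable 𝓜.univ.pol δ,
          (act ⟨red k, hk⟩).inv = (haveI := 𝓜.isLocallyNoetherian
            𝓜.classifyingMap 𝓜.M ({ 𝓜.univ with level := 𝓜.univ.level.twist (red k), symplectic := hs } :
              PolarizedAbelianSchemeWithLevel g N δ 𝓜.M.left))) ∧
      (∀ x : Δ, (ρ.aut x).hom = (act x).hom.left) ∧ ρ.IsGeometricQuotient p.left ∧
      IsFinite p.left ∧ IsSeparated Q.hom ∧ LocallyOfFiniteType Q.hom ∧ IsQuasiProjectiveOver Q ∧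
      (∀ (r : gspFinAdelic δ) (_ : r ∈ principalLevelSubgroup δ N₀) (GN : GL (Fin g ⊕ Fin g) (ZMod N))
        (_ : ∀ (i j : Fin g ⊕ Fin g)
          (h : ((r : GL (Fin g ⊕ Fin g) finAdeleQ) : Matrix (Fin g ⊕ Fin g) (Fin g ⊕ Fin g) finAdeleQ) i j ∈
            FiniteAdeleRing.integralAdeles (𝓞 ℚ) ℚ),
          (GN : Matrix (Fin g ⊕ Fin g) (Fin g ⊕ Fin g) (ZMod N)) i j = integralAdeleResidue N ⟨_, h⟩)
        (hs : (𝓜.univ.level.twist GN).IsSymplecticLiftable 𝓜.univ.pol δ),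
        (haveI := 𝓜.isLocallyNoetherian
         (𝓜.classifyingMap 𝓜.M ({ 𝓜.univ with level := 𝓜.univ.level.twist GN, symplectic := hs } :
           PolarizedAbelianSchemeWithLevel g N δ 𝓜.M.left)).left) ≫ p.left = p.left) ∧
      (∀ (Z : SchemeOver ℚ) [Z.left.IsSeparated] (h : 𝓜.M ⟶ Z),
        (∀ (r : gspFinAdelic δ) (_ : r ∈ principalLevelSubgroup δ N₀) (GN : GL (Fin g ⊕ Fin g) (ZMod N))
          (_ : ∀ (i j : Fin g ⊕ Fin g)
            (h : ((r : GL (Fin g ⊕ Fin g) finAdeleQ) : Matrix (Fin g ⊕ Fin g) (Fin g ⊕ Fin g) finAdeleQ) i j ∈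
              FiniteAdeleRing.integralAdeles (𝓞 ℚ) ℚ),
            (GN : Matrix (Fin g ⊕ Fin g) (Fin g ⊕ Fin g) (ZMod N)) i j = integralAdeleResidue N ⟨_, h⟩)
          (hs : (𝓜.univ.level.twist GN).IsSymplecticLiftable 𝓜.univ.pol δ),
          (haveI := 𝓜.isLocallyNoetherian
           𝓜.classifyingMap 𝓜.M ({ 𝓜.univ with level := 𝓜.univ.level.twist GN, symplectic := hs } :
             PolarizedAbelianSchemeWithLevel g N δ 𝓜.M.left)) ≫ h = h) →
        ∃! hQ : Q ⟶ Z, p ≫ hQ = h) ∧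
      Etale p.left ∧ Surjective p.left ∧ IsLocallyNoetherian Q.left ∧
      (𝓜.univ.changeLevel N₀ d hd (NeZero.ne N)).IsBaseChangeVia X_Q p.left π πh ∧
      IsQuasiProjectiveOver (Over.mk (X_Q.A.X.hom ≫ Q.hom) : SchemeOver ℚ) ∧
      IsQuasiProjectiveOver (Over.mk (X_Q.D.hat.X.hom ≫ Q.hom) : SchemeOver ℚ) := by
  classical
  haveI := 𝓜.isLocallyNoetherian
  haveI : IsSeparated 𝓜.M.hom := hqp.hom_isSeparated
  haveI : LocallyOfFiniteType 𝓜.M.hom := hqp.hom_locallyOfFiniteType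
  -- (Q): the level-`N₀` kernel `Δ` acts, and `p : M → Q = M/Δ` is Mumford's quotient
  obtain ⟨red, Δ, act, Q, p, ρ, hred, hΔ, hΔsurj, hop, hρact, hq, hfin, hsep, hlft, hqpQ, hp, huniv⟩ :=
    𝓜.exists_levelGroupQuotient_action hδ hg N₀ hqp
  haveI := hfin
  haveI := hsep
  haveI := hlft
  haveI : IsLocallyNoetherian Q.left := LocallyOfFiniteType.isLocallyNoetherian Q.hom
  -- (Q-free): the action is free (`N₀ ≥ 3`), so `p` is étale
  have hfree : ∀ (V : Q.left.Opens), IsAffineOpen V → ∀ x : Δ, x ≠ 1 →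
      Ideal.span (Set.range fun s : Γ(𝓜.M.left, p.left ⁻¹ᵁ V) ↦ ρ.act x V s - s) = ⊤ :=
    ρ.free_of_forall_comp_aut_ne fun Ω _ _ t x hx => by
      rw [hρact x]
      exact 𝓜.levelKernel_action_comp_ne hδ hg hd hN₀ red Δ act hred hΔsurj hop t x hx
  have het : Etale p.left := hq.etale_of_free hfree
  -- (O-A): `Δ` acts on the universal `A` and `Â` by automorphisms of the level-`N₀` triple `X`
  obtain ⟨autA, autAh, hX⟩ := 𝓜.exists_action_on_universal_changeLevel hd hN₀ red Δ act hred hΔsurj hop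
  set X : PolarizedAbelianSchemeWithLevel g N₀ δ 𝓜.M.left := 𝓜.univ.changeLevel N₀ d hd (NeZero.ne N) with hXdef
  have hA : ∀ x : Δ, X.A.IsBaseChangeVia X.A (ρ.aut x).hom (autA x).hom := fun x => by
    rw [hρact x]
    exact (hX x).1.1
  have hAh : ∀ x : Δ, X.D.hat.IsBaseChangeVia X.D.hat (ρ.aut x).hom (autAh x).hom := fun x => by
    rw [hρact x]
    exact (hX x).2.1
  -- the dual total space is quasi-projective too (road E, ★ `isQuasiProjectiveOver_univ_hat`)
  have hδ0 : ∏ i, δ i ≠ 0 := Finset.prod_ne_zero_iff.mpr fun i _ => (hδ.1 i).ne'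
  have hqpAh : IsQuasiProjectiveOver (Over.mk (X.D.hat.X.hom ≫ 𝓜.M.hom) : SchemeOver ℚ) :=
    𝓜.isQuasiProjectiveOver_univ_hat hqpA hδ0
  -- FILE A twice: `A` and `Â` descend along `p`, by Mumford quotients of their (quasi-projective) total spaces
  obtain ⟨B, π, ρA, hρA, hπ, hπaff, -, hBsep, hAB, hqpB⟩ :=
    exists_abelianScheme_desc_of_isQuasiProjectiveOver₀ X.A autA hA hqpA hq hfree
  obtain ⟨Bh, πh, ρh, hρh, hπh, -, -, hBhsep, hABh, hqpBh⟩ :=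
    exists_abelianScheme_desc_of_isQuasiProjectiveOver₀ X.D.hat autAh hAh hqpAh hq hfree
  haveI := hBsep
  haveI := hBhsep
  haveI : IsReduced X.D.hat.X.left := X.D.hat.isReduced_left
  haveI : IsProper X.D.hat.X.hom := X.D.hat.isProper
  haveI : IsLocallyNoetherian X.D.hat.X.left := LocallyOfFiniteType.isLocallyNoetherian X.D.hat.X.hom
  have hX' : ∀ x : Δ, X.IsBaseChangeVia X (ρ.aut x).hom (ρA.aut x).hom (ρh.aut x).hom := fun x => by
    rw [hρA x, hρh x, hρact x]
    exact hX x
  -- (10a): the Poincaré bundle, polarisation, type and level descend compatibly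
  obtain ⟨hrel, PB, h1, hrig, hpic, huniv', polB, hT, ψ, hsymp, hN, hbc⟩ :=
    PolarizedAbelianSchemeWithLevel.exists_triple_desc_of_free_base_quotient hq hfree X B hAB ρA Bh hABh ρh hX'
  exact ⟨red, Δ, act, Q, p, ρ, ⟨B, hrel, ⟨Bh, PB, h1, hrig, hpic, huniv'⟩, polB, hT, ψ, hsymp, hN⟩, π, πh, hred, hΔ, hΔsurj,
    hop, hρact, hq, hfin, hsep, hlft, hqpQ, hp, huniv, het, ⟨hq.surjective⟩,
    LocallyOfFiniteType.isLocallyNoetherian Q.hom, hbc, hqpB, hqpBh⟩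

/-- **The same over a SMOOTH carrier** (the (F) clause `Smooth 𝓜.M.hom`; smooth over a field ⇒ reduced, ★
`Motives.isReduced_of_smooth_over_field`): slim form exporting the descended triple, the étale finite surjective
quotient map with its twist-invariance and universal property, and the quasi-projectivity clauses.
[cite: MumfordFogartyKirwan1994, Ch. 7 §3, remark after Thm. 7.9 and Lemma 7.11 (pp. 139–140)]
[cite: MumfordAV1970, §7 Thm. p. 66 and Remark p. 69] -/
theorem exists_univ_desc_levelGroupQuotient_of_smooth [Smooth 𝓜.M.hom] (hδ : IsPolarizationType δ) (hg : 0 < g)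
    {N₀ d : ℕ} [NeZero N₀] (hd : N = N₀ * d) (hN₀ : 3 ≤ N₀) (hqp : IsQuasiProjectiveOver 𝓜.M)
    (hqpA : IsQuasiProjectiveOver (Over.mk (𝓜.univ.A.X.hom ≫ 𝓜.M.hom) : SchemeOver ℚ)) :
    ∃ (Q : SchemeOver ℚ) (p : 𝓜.M ⟶ Q) (X_Q : PolarizedAbelianSchemeWithLevel g N₀ δ Q.left)
      (π : 𝓜.univ.A.X.left ⟶ X_Q.A.X.left) (πh : 𝓜.univ.D.hat.X.left ⟶ X_Q.D.hat.X.left),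
      IsFinite p.left ∧ Etale p.left ∧ Surjective p.left ∧ IsSeparated Q.hom ∧ LocallyOfFiniteType Q.hom ∧
      IsLocallyNoetherian Q.left ∧ IsQuasiProjectiveOver Q ∧
      (∀ (r : gspFinAdelic δ) (_ : r ∈ principalLevelSubgroup δ N₀) (GN : GL (Fin g ⊕ Fin g) (ZMod N))
        (_ : ∀ (i j : Fin g ⊕ Fin g)
          (h : ((r : GL (Fin g ⊕ Fin g) finAdeleQ) : Matrix (Fin g ⊕ Fin g) (Fin g ⊕ Fin g) finAdeleQ) i j ∈
            FiniteAdeleRing.integralAdeles (𝓞 ℚ) ℚ),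
          (GN : Matrix (Fin g ⊕ Fin g) (Fin g ⊕ Fin g) (ZMod N)) i j = integralAdeleResidue N ⟨_, h⟩)
        (hs : (𝓜.univ.level.twist GN).IsSymplecticLiftable 𝓜.univ.pol δ),
        (haveI := 𝓜.isLocallyNoetherian
         (𝓜.classifyingMap 𝓜.M ({ 𝓜.univ with level := 𝓜.univ.level.twist GN, symplectic := hs } :
           PolarizedAbelianSchemeWithLevel g N δ 𝓜.M.left)).left) ≫ p.left = p.left) ∧
      (∀ (Z : SchemeOver ℚ) [Z.left.IsSeparated] (h : 𝓜.M ⟶ Z),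
        (∀ (r : gspFinAdelic δ) (_ : r ∈ principalLevelSubgroup δ N₀) (GN : GL (Fin g ⊕ Fin g) (ZMod N))
          (_ : ∀ (i j : Fin g ⊕ Fin g)
            (h : ((r : GL (Fin g ⊕ Fin g) finAdeleQ) : Matrix (Fin g ⊕ Fin g) (Fin g ⊕ Fin g) finAdeleQ) i j ∈
              FiniteAdeleRing.integralAdeles (𝓞 ℚ) ℚ),
            (GN : Matrix (Fin g ⊕ Fin g) (Fin g ⊕ Fin g) (ZMod N)) i j = integralAdeleResidue N ⟨_, h⟩)
          (hs : (𝓜.univ.level.twist GN).IsSymplecticLiftable 𝓜.univ.pol δ),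
          (haveI := 𝓜.isLocallyNoetherian
           𝓜.classifyingMap 𝓜.M ({ 𝓜.univ with level := 𝓜.univ.level.twist GN, symplectic := hs } :
             PolarizedAbelianSchemeWithLevel g N δ 𝓜.M.left)) ≫ h = h) →
        ∃! hQ : Q ⟶ Z, p ≫ hQ = h) ∧
      (𝓜.univ.changeLevel N₀ d hd (NeZero.ne N)).IsBaseChangeVia X_Q p.left π πh ∧
      IsQuasiProjectiveOver (Over.mk (X_Q.A.X.hom ≫ Q.hom) : SchemeOver ℚ) ∧
      IsQuasiProjectiveOver (Over.mk (X_Q.D.hat.X.hom ≫ Q.hom) : SchemeOver ℚ) := by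
  haveI : IsReduced 𝓜.M.left := Literature.AlgebraicGeometry.Motives.isReduced_of_smooth_over_field 𝓜.M.hom
  obtain ⟨-, -, -, Q, p, -, X_Q, π, πh, -, -, -, -, -, -, hfin, hsep, hlft, hqpQ, hp, huniv, het, hsurj, hnoeth, hbc,
    hqpB, hqpBh⟩ := 𝓜.exists_univ_desc_levelGroupQuotient hδ hg hd hN₀ hqp hqpA
  exact ⟨Q, p, X_Q, π, πh, hfin, het, hsurj, hsep, hlft, hnoeth, hqpQ, hp, huniv, hbc, hqpB, hqpBh⟩

end SiegelFineModuliScheme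

end Literature.AlgebraicGeometry.ModuliOfAbelianVarieties

end
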